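import Literature.NumberTheory.EllipticCurves.TateModuleFreeProofs
import Literature.NumberTheory.EllipticCurves.GaloisActionProofs
import Literature.NumberTheory.GaloisRepresentations.GaloisCohomology
import Mathlib.Topology.Instances.ZMod
import Mathlib.NumberTheory.Padics.ProperSpace
import Mathlib.Topology.Algebra.Module.ModuleTopology
import Mathlib.Topology.Maps.OpenQuotient
import HarnessLib

/-!
# Continuity of the Galois action on `T_p E` and `V_p E` (discharges)

D-0014 keeps `Literature/` sorry-free by stating cited results as named facts `def X : Prop`.
This pure-proof sibling of `Literature.NumberTheory.EllipticCurves.TateModule` proves, as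
`theorem X_holds : X`, its two continuity facts (Serre, *Abelian ℓ-adic representations and
elliptic curves* (1968), Ch. I §1.1 (an `ℓ`-adic representation is a *continuous* homomorphism
`Γ_K → Aut(V)`) and §1.2 (the example `V_ℓ(E) = T_ℓ(E) ⊗ ℚ_ℓ` of an elliptic curve); Silverman,
*AEC*, III.§7):

* `WeierstrassCurve.continuous_galoisRepTate_holds W p` — the action `Γ_F × T_p E → T_p E` is
  jointly continuous (Krull topology on `Γ_F`, profinite topology on `T_p E`);
* `WeierstrassCurve.continuous_rationalGaloisRepTate_holds W p` — the action
  `Γ_F × V_p E → V_p E` is jointly continuous (`ℚ_p`-module topology on `V_p E`).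

Both hold for every prime `p`, including `p = char F`.

## Proof

1. `E(F̄)` is a discrete `Γ_F`-module: stabilisers of points are open
   (`WeierstrassCurve.isOpen_stabilizer_point_holds`, `GaloisActionProofs`), which for a discrete
   space is joint continuity of the action (Mathlib `continuousSMul_iff_stabilizer_isOpen`);
   recorded as `WeierstrassCurve.continuousSMul_geomPoints'` (the same statement is proved, with
   heavy imports, as `continuousSMul_geomPoints` in `SelmerCorankProofs`; primed to avoid the
   clash for files importing both).
2. Generic (`Literature.NumberTheory.EllipticCurves.TateModule.continuousSMul_of_continuousSMul`): if a monoid `G` acts on the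
   topological abelian group `A` jointly continuously, it acts jointly continuously on
   `T_p A ⊆ ∏_n A` (product topology), because each coordinate of `g • a` is `g • a_n`
   (`proj_smul_of_distribMulAction`).  With 1 this gives `continuous_galoisRepTate_holds`.
3. Generic, for discrete `A` with `T_p A` finitely generated over `ℤ_p`
   (`module_finite_tateModule_holds`, `TateModuleFreeProofs`, Silverman III.7.1): the profinite
   topology of `T_p A` *is* its `ℤ_p`-module topology (`Literature.NumberTheory.EllipticCurves.TateModule.isModuleTopology`).
   Indeed `ℤ_p` acts continuously on `T_p A` (`TateModule.continuousSMul_padicInt`: coordinate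
   `n` of
   `x • a` is `(x mod pⁿ) • a_n` and `x ↦ x mod pⁿ` is locally constant,
   `Literature.NumberTheory.GaloisRepresentations.PadicInt.continuous_toZModPow` of `GaloisCohomology`), so the module topology is finer
   (`moduleTopology_le`); the module topology of a finite module over the compact ring `ℤ_p` is
   compact (image of `ℤ_pⁿ`, `Literature.NumberTheory.EllipticCurves.compactSpace_moduleTopology_of_finite`), the profinite topology
   is Hausdorff (`TateModule.t2Space`), and a continuous bijection from a compact space to a
   Hausdorff space is a
   homeomorphism (Mathlib `Continuous.continuous_symm_of_equiv_compact_to_t2`;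
   `Literature.NumberTheory.EllipticCurves.isModuleTopology_of_compactSpace_moduleTopology`).
4. Hence `T_p A → V_p A = ℚ_p ⊗ T_p A` is continuous (`TateModule.continuous_toRational`: a
   `ℤ_p`-linear map out of a module carrying the module topology, Mathlib
   `IsModuleTopology.continuous_of_linearMap`; `ℤ_p` acts continuously on `V_p A` through
   `ℤ_p ⊆ ℚ_p`, `RationalTateModule.continuousSMul_padicInt`).
5. `Literature.NumberTheory.EllipticCurves.continuous_rationalTateRepresentation`: choose `ℤ_p`-generators `t₁, …, tₙ` of `T_p A`;
   then `π : ℚ_pⁿ → V_p A`, `c ↦ ∑ cᵢ tᵢ`, is a surjective `ℚ_p`-linear map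
   (`RationalTateModule.exists_eq_sum`, by induction on tensors), hence an open quotient map for
   the module topologies (Mathlib `IsModuleTopology.isOpenQuotientMap_of_surjective`), and so is
   `id × π : G × ℚ_pⁿ → G × V_p A`.  The action pulled back along `id × π` is
   `(g, c) ↦ ∑ cᵢ · (g • tᵢ)` (`rationalTateRepresentation_toRational`), continuous by 2 and 4;
   continuity descends along the open quotient map (`IsOpenQuotientMap.continuous_comp_iff`).
   With 1 and `module_finite_tateModule_holds` this gives `continuous_rationalGaloisRepTate_holds`.

## Design

`noncomputable section`, `open scoped Classical`, `universe u` (`A F : Type u`) as in the parent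
file.  Theorems only — no definitions and no instances: the class-valued statements
(`TateModule.t2Space`, `TateModule.continuousSMul_of_continuousSMul`,
`TateModule.continuousSMul_padicInt`, `TateModule.isModuleTopology`,
`RationalTateModule.continuousSMul_padicInt`, `WeierstrassCurve.continuousSMul_geomPoints'`) are
theorems, installed locally with `haveI` where needed, following the parent files' convention
that structure facts about `T_p E` are consumed as explicit hypotheses, never as instances.
Mathlib: `moduleTopology`, `IsModuleTopology.{continuous_of_linearMap,
isOpenQuotientMap_of_surjective, toContinuousAdd}`, `IsOpenQuotientMap.{id, prodMap,
continuous_comp_iff}`, `Continuous.continuous_symm_of_equiv_compact_to_t2`,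
`continuousSMul_iff_stabilizer_isOpen`, `PadicInt.compactSpace` (`Padics.ProperSpace`),
`Module.Finite.exists_fin'`, `TensorProduct.induction_on`.

## References

* J.-P. Serre, *Abelian ℓ-adic representations and elliptic curves* (1968), Ch. I §1.1
  (definition of an `ℓ`-adic representation: continuity), §1.2 (examples: `T_ℓ(μ)`, `V_ℓ(E)`).
  [SerreAbelianLadic1968]
* J. H. Silverman, *The Arithmetic of Elliptic Curves*, 2nd ed. (2009), III.§7 (the `ℓ`-adic
  representation `ρ_ℓ : Γ_K → Aut(T_ℓ(E))` is continuous for the profinite topologies),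
  Prop. III.7.1. [SilvermanAEC2009]
-/

noncomputable section

open scoped Classical TensorProduct
open Topology

universe u

namespace Literature.NumberTheory.EllipticCurves

/-! ### The module topology of a finite module over a compact ring -/

section ModuleTopology

/-- The module topology of a finitely generated module over a compact topological ring is
compact: `M` is the continuous image of `Rⁿ` (`Module.Finite.exists_fin'`,
`IsModuleTopology.continuous_of_linearMap`). [folklore] -/
theorem compactSpace_moduleTopology_of_finite (R : Type*) (M : Type*) [CommRing R]
    [TopologicalSpace R] [IsTopologicalRing R] [CompactSpace R] [AddCommGroup M] [Module R M]
    [Module.Finite R M] : @CompactSpace M (moduleTopology R M) := by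
  letI : TopologicalSpace M := moduleTopology R M
  haveI : IsModuleTopology R M := ⟨rfl⟩
  haveI : ContinuousAdd M := IsModuleTopology.toContinuousAdd R M
  obtain ⟨n, f, hf⟩ := Module.Finite.exists_fin' R M
  have hc : Continuous f := IsModuleTopology.continuous_of_linearMap f
  exact ⟨by rw [← Set.image_univ_of_surjective hf]; exact isCompact_univ.image hc⟩

/-- A Hausdorff topological `R`-module structure `τ` on `M` whose module topology is compact *is*
the module topology: the module topology is finer (`moduleTopology_le`), and a continuous
bijection from a compact space onto a Hausdorff space is a homeomorphism (Mathlib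
`Continuous.continuous_symm_of_equiv_compact_to_t2`). [folklore] -/
theorem isModuleTopology_of_compactSpace_moduleTopology (R : Type*) (M : Type*) [CommRing R]
    [TopologicalSpace R] [AddCommGroup M] [Module R M] [τ : TopologicalSpace M] [T2Space M]
    [ContinuousAdd M] [ContinuousSMul R M] (hc : @CompactSpace M (moduleTopology R M)) :
    IsModuleTopology R M := by
  have hle : moduleTopology R M ≤ τ := moduleTopology_le R M
  have h1 : Continuous[moduleTopology R M, τ] (Equiv.refl M) := continuous_id_of_le hle
  have h2 : Continuous[τ, moduleTopology R M] (Equiv.refl M).symm :=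
    @Continuous.continuous_symm_of_equiv_compact_to_t2 M M (moduleTopology R M) τ hc _ _ h1
  exact ⟨le_antisymm (continuous_id_iff_le.1 h2) hle⟩

/-- A Hausdorff topological module structure on a finitely generated module over a compact
topological ring is the module topology (`compactSpace_moduleTopology_of_finite` and
`isModuleTopology_of_compactSpace_moduleTopology`).  Applied below to `T_p A` over `ℤ_p`.
[folklore] -/
theorem isModuleTopology_of_finite_of_compactSpace (R : Type*) (M : Type*) [CommRing R]
    [TopologicalSpace R] [IsTopologicalRing R] [CompactSpace R] [AddCommGroup M] [Module R M]
    [Module.Finite R M] [TopologicalSpace M] [T2Space M] [ContinuousAdd M] [ContinuousSMul R M] :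
    IsModuleTopology R M :=
  isModuleTopology_of_compactSpace_moduleTopology R M (compactSpace_moduleTopology_of_finite R M)

end ModuleTopology

/-! ### Topology of the Tate module -/

namespace TateModule

variable {A : Type u} [AddCommGroup A] {p : ℕ}

/-- `T_p A ⊆ ∏_n A` is Hausdorff when `A` is. Serre (1968), Ch. I §1.1. [folklore] -/
theorem t2Space [TopologicalSpace A] [T2Space A] : T2Space (TateModule A p) :=
  inferInstanceAs (T2Space (tateSubgroup A p))

/-- If a monoid `G` acts jointly continuously on the topological abelian group `A` (by group
endomorphisms), it acts jointly continuously on `T_p A` (product topology): coordinate `n` of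
`g • a` is `g • a_n` (`proj_smul_of_distribMulAction`).  For `A = E(F̄)` discrete this is the
continuity of `Γ_F × T_p E → T_p E`. Serre (1968), Ch. I §1.1–1.2; Silverman, *AEC*, III.§7.
[folklore] -/
theorem continuousSMul_of_continuousSMul {G : Type*} [Monoid G] [TopologicalSpace G]
    [DistribMulAction G A] [TopologicalSpace A] [ContinuousSMul G A] :
    ContinuousSMul G (TateModule A p) where
  continuous_smul := by
    refine continuous_induced_rng.2 (continuous_pi fun n => ?_)
    change Continuous fun x : G × TateModule A p => proj p n (x.1 • x.2)
    simp only [proj_smul_of_distribMulAction]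
    exact continuous_fst.smul ((continuous_proj n).comp continuous_snd)

variable [Fact p.Prime]

/-- For discrete `A`, the `ℤ_p`-module structure of `T_p A` is jointly continuous: coordinate
`n` of `x • a` is `(x mod pⁿ).val • a_n` (`proj_smul`), and `x ↦ x mod pⁿ` is continuous into the
discrete `ℤ/pⁿ` (`Literature.NumberTheory.GaloisRepresentations.PadicInt.continuous_toZModPow`). Serre (1968), Ch. I §1.1. [folklore] -/
theorem continuousSMul_padicInt [TopologicalSpace A] [DiscreteTopology A] :
    ContinuousSMul ℤ_[p] (TateModule A p) where
  continuous_smul := by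
    refine continuous_induced_rng.2 (continuous_pi fun n => ?_)
    change Continuous fun x : ℤ_[p] × TateModule A p => proj p n (x.1 • x.2)
    simp only [proj_smul]
    have h1 : Continuous fun x : ℤ_[p] × TateModule A p =>
        ((PadicInt.toZModPow n x.1).val, proj p n x.2) :=
      ((continuous_of_discreteTopology (f := ZMod.val)).comp
        ((Literature.NumberTheory.GaloisRepresentations.PadicInt.continuous_toZModPow p n).comp continuous_fst)).prodMk
        ((continuous_proj n).comp continuous_snd)
    exact (continuous_of_discreteTopology (f := fun kP : ℕ × A => kP.1 • kP.2)).comp h1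

/-- **The profinite topology of `T_p A` is its `ℤ_p`-module topology** (for `A` discrete and
`T_p A` finitely generated over `ℤ_p`, e.g. `A = E(F̄)`): `T_p A` is a Hausdorff topological
`ℤ_p`-module (`t2Space`, `continuousSMul_padicInt`), finitely generated over the compact ring
`ℤ_p` (`isModuleTopology_of_finite_of_compactSpace`).  Serre (1968), Ch. I §1.1 (`T_ℓ` is a free
`ℤ_ℓ`-module of finite rank "on which `G` acts continuously"). [folklore] -/
theorem isModuleTopology [TopologicalSpace A] [DiscreteTopology A]
    [Module.Finite ℤ_[p] (TateModule A p)] : IsModuleTopology ℤ_[p] (TateModule A p) := by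
  haveI := t2Space (A := A) (p := p)
  haveI := continuousSMul_padicInt (A := A) (p := p)
  exact isModuleTopology_of_finite_of_compactSpace ℤ_[p] (TateModule A p)

end TateModule

namespace RationalTateModule

variable {A : Type u} [AddCommGroup A] {p : ℕ} [Fact p.Prime]

/-- `ℤ_p` acts continuously on `V_p A = ℚ_p ⊗_{ℤ_p} T_p A` (module topology over `ℚ_p`), through
the continuous inclusion `ℤ_p ⊆ ℚ_p` (`algebraMap_smul`). [folklore] -/
theorem continuousSMul_padicInt : ContinuousSMul ℤ_[p] (RationalTateModule A p) where
  continuous_smul := by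
    have : (fun x : ℤ_[p] × RationalTateModule A p => x.1 • x.2) =
        fun x => (x.1 : ℚ_[p]) • x.2 := by
      funext x
      exact (algebraMap_smul ℚ_[p] x.1 x.2).symm
    rw [this]
    exact ((continuous_subtype_val : Continuous ((↑) : ℤ_[p] → ℚ_[p])).comp
      continuous_fst).smul continuous_snd

end RationalTateModule

section Rational

variable {A : Type u} [AddCommGroup A] (p : ℕ) [Fact p.Prime]

/-- The natural map `T_p A → V_p A`, `x ↦ 1 ⊗ x`, is continuous when `A` is discrete and `T_p A`
is finitely generated over `ℤ_p`: it is `ℤ_p`-linear out of a module carrying the module topology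
(`TateModule.isModuleTopology`, Mathlib `IsModuleTopology.continuous_of_linearMap`, with
`RationalTateModule.continuousSMul_padicInt`). Serre (1968), Ch. I §1.2. [folklore] -/
theorem TateModule.continuous_toRational [TopologicalSpace A] [DiscreteTopology A]
    [Module.Finite ℤ_[p] (TateModule A p)] :
    Continuous (TateModule.toRational p : TateModule A p → RationalTateModule A p) := by
  haveI := TateModule.isModuleTopology (A := A) (p := p)
  haveI := RationalTateModule.continuousSMul_padicInt (A := A) (p := p)
  exact IsModuleTopology.continuous_of_linearMap _

/-- Every element of `V_p A = ℚ_p ⊗_{ℤ_p} T_p A` is a `ℚ_p`-linear combination `∑ cᵢ (1 ⊗ tᵢ)` of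
the images of `ℤ_p`-generators `tᵢ = f(eᵢ)` of `T_p A` (induction on tensors). [folklore] -/
theorem RationalTateModule.exists_eq_sum {n : ℕ} (f : (Fin n → ℤ_[p]) →ₗ[ℤ_[p]] TateModule A p)
    (hf : Function.Surjective f) (v : RationalTateModule A p) :
    ∃ c : Fin n → ℚ_[p], v = ∑ i, c i • TateModule.toRational p (f (Pi.single i 1)) := by
  change ℚ_[p] ⊗[ℤ_[p]] TateModule A p at v
  induction v using TensorProduct.induction_on with
  | zero =>
    refine ⟨0, ?_⟩
    change (0 : RationalTateModule A p) = _
    simp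
  | tmul c t =>
    obtain ⟨a, rfl⟩ := hf t
    refine ⟨fun i => (a i : ℚ_[p]) * c, ?_⟩
    have ha : a = ∑ i, a i • (Pi.single i (1 : ℤ_[p]) : Fin n → ℤ_[p]) := by
      ext j
      simp [Finset.sum_apply, Pi.single_apply]
    conv_lhs => rw [ha, map_sum, TensorProduct.tmul_sum]
    change (∑ i, c ⊗ₜ[ℤ_[p]] f (a i • Pi.single i 1) : ℚ_[p] ⊗[ℤ_[p]] TateModule A p) =
      ∑ i, ((a i : ℚ_[p]) * c) • ((1 : ℚ_[p]) ⊗ₜ[ℤ_[p]] f (Pi.single i 1))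
    refine Finset.sum_congr rfl fun i _ => ?_
    rw [map_smul, ← TensorProduct.smul_tmul, TensorProduct.smul_tmul', smul_eq_mul, mul_one,
      Algebra.smul_def, PadicInt.algebraMap_apply]
  | add x y hx hy =>
    obtain ⟨c, rfl⟩ := hx
    obtain ⟨d, rfl⟩ := hy
    refine ⟨c + d, ?_⟩
    change (_ : RationalTateModule A p) + _ = _
    simp [add_smul, Finset.sum_add_distrib]

/-- **Continuity of the rational Tate representation.**  If a topological monoid `G` acts jointly
continuously on the discrete abelian group `A` and `T_p A` is finitely generated over `ℤ_p`, then
`G × V_p A → V_p A`, `(g, v) ↦ rationalTateRepresentation G A p g v`, is jointly continuous for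
the `ℚ_p`-module topology on `V_p A`.  Proof: with `ℤ_p`-generators `t₁, …, tₙ` of `T_p A`, the
surjection `π : ℚ_pⁿ → V_p A`, `c ↦ ∑ cᵢ (1 ⊗ tᵢ)` (`RationalTateModule.exists_eq_sum`) is an open
quotient map (Mathlib `IsModuleTopology.isOpenQuotientMap_of_surjective`), so is `id × π`, and
the action pulled back along it, `(g, c) ↦ ∑ cᵢ (1 ⊗ g • tᵢ)`
(`rationalTateRepresentation_toRational`), is continuous by
`TateModule.continuousSMul_of_continuousSMul` and `TateModule.continuous_toRational`.
Serre (1968), Ch. I §1.1–1.2 (`V_ℓ = T_ℓ ⊗ ℚ_ℓ` is an `ℓ`-adic representation of `G`).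
[cite: SerreAbelianLadic1968, Ch. I §1.1–1.2] -/
theorem continuous_rationalTateRepresentation {G : Type*} [Monoid G] [TopologicalSpace G]
    [DistribMulAction G A] [TopologicalSpace A] [DiscreteTopology A] [ContinuousSMul G A]
    [Module.Finite ℤ_[p] (TateModule A p)] :
    Continuous fun x : G × RationalTateModule A p =>
      rationalTateRepresentation G A p x.1 x.2 := by
  haveI := TateModule.continuousSMul_of_continuousSMul (A := A) (p := p) (G := G)
  obtain ⟨n, f, hf⟩ := Module.Finite.exists_fin' ℤ_[p] (TateModule A p)
  let t : Fin n → RationalTateModule A p := fun i => TateModule.toRational p (f (Pi.single i 1))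
  let π : (Fin n → ℚ_[p]) →ₗ[ℚ_[p]] RationalTateModule A p :=
    ∑ i, (LinearMap.proj i).smulRight (t i)
  have hπ_apply : ∀ c, π c = ∑ i, c i • t i := fun c => by
    simp [π, LinearMap.sum_apply]
  have hπ : Function.Surjective π := fun v => by
    obtain ⟨c, hc⟩ := RationalTateModule.exists_eq_sum p f hf v
    exact ⟨c, by rw [hπ_apply, hc]⟩
  have hq : IsOpenQuotientMap
      (Prod.map id π : G × (Fin n → ℚ_[p]) → G × RationalTateModule A p) :=
    IsOpenQuotientMap.id.prodMap (IsModuleTopology.isOpenQuotientMap_of_surjective hπ)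
  rw [← hq.continuous_comp_iff]
  have heq : ((fun x : G × RationalTateModule A p => rationalTateRepresentation G A p x.1 x.2) ∘
      Prod.map id π) =
      fun x => ∑ i, x.2 i • TateModule.toRational p (x.1 • f (Pi.single i 1)) := by
    funext x
    simp only [Function.comp_apply, Prod.map_fst, Prod.map_snd, id_eq, hπ_apply, map_sum,
      map_smul, t, rationalTateRepresentation_toRational]
  rw [heq]
  refine continuous_finsetSum _ fun i _ => ?_
  exact ((continuous_apply i).comp continuous_snd).smul
    ((TateModule.continuous_toRational p).comp (continuous_fst.smul continuous_const))

end Rational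

end Literature.NumberTheory.EllipticCurves

/-! ### Elliptic curves -/

namespace WeierstrassCurve

open Literature.NumberTheory.EllipticCurves

variable {F : Type u} [Field F] (W : WeierstrassCurve F) (p : ℕ) [Fact p.Prime]

/-- `E(F̄)` is a discrete `Γ_F`-module: the action `Γ_F × E(F̄) → E(F̄)` is jointly continuous for
the discrete topology on `E(F̄)`, because stabilisers of points are open
(`isOpen_stabilizer_point_holds`, `GaloisActionProofs`; Mathlib
`continuousSMul_iff_stabilizer_isOpen`).  The same statement is `continuousSMul_geomPoints` of
`SelmerCorankProofs` (heavier imports); primed here. Serre, *Galois Cohomology*, II.§1;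
Silverman, *AEC*, VIII.§1. [folklore] -/
theorem continuousSMul_geomPoints' : ContinuousSMul (Field.absoluteGaloisGroup F) (geomPoints W) :=
  continuousSMul_iff_stabilizer_isOpen.2 (isOpen_stabilizer_point_holds W)

/-- **Discharge of `WeierstrassCurve.continuous_galoisRepTate`** (Serre (1968), Ch. I §1.1–1.2;
Silverman, *AEC*, III.§7: `ρ_p : Γ_F → Aut(T_p E)` is continuous): the Galois action
`Γ_F × T_p E → T_p E` is jointly continuous, for every prime `p` — `E(F̄)` is a discrete
`Γ_F`-module (`continuousSMul_geomPoints'`) and the action on `T_p E ⊆ ∏_n E[pⁿ]` is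
coordinatewise (`TateModule.continuousSMul_of_continuousSMul`).
[cite: SerreAbelianLadic1968, Ch. I §1.1–1.2] -/
theorem continuous_galoisRepTate_holds : continuous_galoisRepTate W p := by
  haveI := continuousSMul_geomPoints' W
  haveI := TateModule.continuousSMul_of_continuousSMul (A := geomPoints W) (p := p)
    (G := Field.absoluteGaloisGroup F)
  exact continuous_smul

/-- **Discharge of `WeierstrassCurve.continuous_rationalGaloisRepTate`** (Serre (1968), Ch. I
§1.1–1.2: `V_p(E) = T_p(E) ⊗ ℚ_p` is a `p`-adic representation of `Γ_F`): for an elliptic curve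
the Galois action `Γ_F × V_p E → V_p E` is jointly continuous for the `ℚ_p`-module topology, for
every prime `p` — `Literature.NumberTheory.EllipticCurves.continuous_rationalTateRepresentation` with `E(F̄)` discrete
(`continuousSMul_geomPoints'`) and `T_p E` finitely generated over `ℤ_p`
(`module_finite_tateModule_holds`, Silverman III.7.1). [cite: SerreAbelianLadic1968, Ch. I §1.1–1.2] -/
theorem continuous_rationalGaloisRepTate_holds : continuous_rationalGaloisRepTate W p := by
  intro _
  haveI := continuousSMul_geomPoints' W
  haveI : Module.Finite ℤ_[p] (W.tateModule p) := module_finite_tateModule_holds W p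
  exact continuous_rationalTateRepresentation p

end WeierstrassCurve
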